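import Summits.ResolutionOfSingularities.ResolutionOfSingularities.Theorems.FrobeniusLadderFInjectiveMacaulayficationRegularOffCodimFourResidue
import Literature.AlgebraicGeometry.Resolution.ComponentGluing
import HarnessLib

/-!
# LINE U, (U1) `RegularOffCodimFourResidue` for REDUCED `X` (component separation) — strat-1's text VERBATIM
# (crux `FInjectiveMacaulayfication` stmt-ResolutionOfSingularities-15315, chain w45a; res-L1-w45a-plan-1 R15.35 (2) / R15.36 (1)
# «stub-3: reduced sibling (component glue; export `B ⊆ (Reg X)ᶜ`)»; typed target = res-L1-w45a-strat-1 `ULine.lean` v1.5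
# `UReduction.RegularOffCodimFourResidue`; seat res-L1-w45a-stub-3)

[OURS · L1 W4.5a] Support file (`--supports stmt-ResolutionOfSingularities-15315 --as helper`); NOT a statement of any manuscript; AI-written
(AI review is weaker than expert review). CONDITIONAL on `CossartPiltant2019General`, `Stacks081R`, `CossartPiltant2019Principalization` BY NAME.

* `RegularOffCodimFourModel X` — the U1 predicate on a scheme `X`: a proper birational reduced `X₂ → X` and a closed `B ⊆ X` of points of
  local dimension `≥ 4` off whose preimage `X₂` is regular;
* `regularOffCodimFourModel_of_isIntegral` — the integral case (`RegularOffCodimFourResidue.regularOffCodimFourResidue_of_isIntegral`);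
  `exists_isBlowup_regular_off_codimFour_singular` — its blow-up form with the residue taken INSIDE `Sing X` (res-L1-w45a-tri-2's
  remark / plan-1 R15.35 (2): intersect the residue with `Sing X`; the blowing up is an isomorphism over `Reg X ⊆ (Supp J)ᶜ`);
* the component glue, copied from `Literature.AlgebraicGeometry.Resolution.ComponentGluing` (Cossart–Piltant 2019, proof of Prop. 4.6,
  Step 1) with `Scheme.HasResolution` replaced by `RegularOffCodimFourModel`: `…_of_closed_cover` (the model of `X` is the disjoint
  union of the models of two closed pieces with mutually dense complements — proper `ComponentGluing.isProper_coprodDesc`, birational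
  `ComponentGluing.isBirational_coprodDesc_of_closed_cover`, reduced; residue = union of the images of the two residues, local
  dimension only grows along a closed immersion), `…_of_iso`, `…_of_isRegular`, `…_subscheme_biUnion` (induction on the number of
  components), `…_of_irreducibleComponents`, `…_of_forall_closeds`;
* **`regularOffCodimFourResidue_of_cp (hG) (h081R) (hP) : <ULine v1.5 `RegularOffCodimFourResidue` VERBATIM>`** — U1 for every REDUCED
  separated finite-type `k`-scheme: `stub_regularOffCodimFourResidue` closes by it (modulo the three named facts).
[folklore assembly; cite: Temkin2008, Prop. 2.3.4; CossartPiltant2019, Thm. 1.1 and proof of Prop. 4.6 (Step 1)]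
-/

-- single-problem summit: the doubled namespace component is forced
set_option linter.dupNamespace false

noncomputable section

open CategoryTheory CategoryTheory.Limits AlgebraicGeometry TopologicalSpace Topology IsLocalRing
open Literature.AlgebraicGeometry.Resolution

namespace Summit.ResolutionOfSingularities.ResolutionOfSingularities.Theorems.FInjectiveMacaulayfication.RegularOffCodimFourResidueReduced

open Summit.ResolutionOfSingularities.ResolutionOfSingularities.Theorems.FInjectiveMacaulayfication
open Scheme.IdealSheafData

/-! ## §1 The U1 predicate and its integral case -/

/-- **The U1 predicate**: `X` has a proper birational reduced model `X₂ → X` regular off the preimage of a closed set `B ⊆ X` all of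
whose points have local rings of dimension `≥ 4` (Temkin 2008 Def. 2.2.6 «desingularization up to codimension < 4», proper currency).
[OURS packaging of res-L1-w45a-strat-1's `UReduction.RegularOffCodimFourResidue` conclusion] -/
def RegularOffCodimFourModel (X : Scheme.{0}) : Prop :=
  ∃ (X₂ : Scheme.{0}) (π₂ : X₂ ⟶ X), IsProper π₂ ∧ IsBirational π₂ ∧ IsReduced X₂ ∧
    ∃ B : Set X, IsClosed B ∧ (∀ b ∈ B, (4 : WithBot ℕ∞) ≤ ringKrullDim (X.presheaf.stalk b)) ∧
      ∀ x₂ : X₂, π₂.base x₂ ∉ B → IsRegularLocalRing (X₂.presheaf.stalk x₂)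

/-- The integral case, characteristic-free (the proof of `RegularOffCodimFourResidue.regularOffCodimFourResidue_of_isIntegral` without
its dummy prime): `dim X ≥ 3` by the truncated Temkin induction `exists_isBlowup_regular_off_codimFour`, `dim X ≤ 2` by Cossart–Piltant
outright. [folklore assembly; cite: Temkin2008, Prop. 2.3.4; CossartPiltant2019, Thm. 1.1] -/
theorem regularOffCodimFourModel_of_isIntegral
    (hG : CossartPiltant2019General.{0}) (h081R : Stacks081R.{0}) (hP : CossartPiltant2019Principalization.{0})
    {k : Type} [Field k] (X : Scheme.{0}) (f : X ⟶ Spec (.of k)) [IsSeparated f] [LocallyOfFiniteType f] [QuasiCompact f]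
    [IsIntegral X] : RegularOffCodimFourModel X := by
  haveI : IsLocallyNoetherian X := LocallyOfFiniteType.isLocallyNoetherian f
  haveI : CompactSpace X := QuasiCompact.compactSpace_of_compactSpace f
  haveI : IsNoetherian X := {}
  by_cases h3 : (3 : WithBot ℕ∞) ≤ topologicalKrullDim X
  · obtain ⟨X', f', J, hf', hJ, B, hB, hB4, hreg⟩ :=
      RegularOffCodimFourResidue.exists_isBlowup_regular_off_codimFour hG h081R hP f h3
    have hJne : J ≠ ⊥ := by
      intro h0
      have hgen : genericPoint X ∈ (J.support : Set X) := by rw [h0, Scheme.IdealSheafData.support_bot]; trivial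
      have := hJ hgen
      rw [Set.mem_compl_iff, Scheme.mem_regularLocus] at this
      exact this (inferInstanceAs (IsRegularLocalRing X.functionField))
    haveI : IsIntegral X' := hf'.isIntegral hJne
    exact ⟨X', f', hf'.isProper, hf'.isBirational' hJne, inferInstance, B, hB, hB4, hreg⟩
  · haveI : X.IsSeparated := Scheme.isSeparated_of_isSeparated_over f
    have hqe : Scheme.IsQuasiExcellent X := Scheme.isQuasiExcellent_of_locallyOfFiniteType Stacks07QW_field_holds f
    have hdim : topologicalKrullDim X ≤ 3 := le_of_lt (lt_of_not_ge h3)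
    obtain ⟨X', π, hπ, -, -, -⟩ := hG X hqe hdim
    exact ⟨X', π, hπ.isProper, hπ.isBirational, hπ.isRegular.isReduced, ∅, isClosed_empty, fun _ h => absurd h (Set.notMem_empty _),
      fun x' _ => hπ.isRegular x'⟩

/-- **The residue may be taken inside `Sing X`** (integral case, blow-up form; res-L1-w45a-tri-2's remark, plan-1 R15.35 (2)): intersect
the residue with `Sing X` — over `Reg X ⊆ (Supp J)ᶜ` the blowing up is an isomorphism, so `X'` is regular there anyway.
[folklore; cite: Temkin2008, Prop. 2.3.4] -/
theorem exists_isBlowup_regular_off_codimFour_singular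
    (hG : CossartPiltant2019General.{0}) (h081R : Stacks081R.{0}) (hP : CossartPiltant2019Principalization.{0})
    {k : Type} [Field k] {X : Scheme.{0}} (f₀ : X ⟶ Spec (.of k)) [IsIntegral X] [LocallyOfFiniteType f₀] [QuasiCompact f₀]
    (h3 : (3 : WithBot ℕ∞) ≤ topologicalKrullDim X) :
    ∃ (X' : Scheme.{0}) (f : X' ⟶ X) (J : X.IdealSheafData), IsBlowup f J ∧
      (J.support : Set X) ⊆ (Scheme.regularLocus X)ᶜ ∧
      ∃ B : Set X, IsClosed B ∧ B ⊆ (Scheme.regularLocus X)ᶜ ∧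
        (∀ b ∈ B, (4 : WithBot ℕ∞) ≤ ringKrullDim (X.presheaf.stalk b)) ∧
        ∀ x' : X', f x' ∉ B → IsRegularLocalRing (X'.presheaf.stalk x') := by
  haveI : IsLocallyNoetherian X := LocallyOfFiniteType.isLocallyNoetherian f₀
  have hk : Scheme.IsQuasiExcellent (Spec (.of k)) :=
    Scheme.isQuasiExcellent_of_locallyOfFiniteType Stacks07QW_field_holds (𝟙 (Spec (.of k)))
  have hTc : IsClosed (Scheme.regularLocus X)ᶜ := isClosed_compl_regularLocus_of_locallyOfFiniteType f₀ hk
  obtain ⟨X', f, J, hf, hJ, B, hB, hB4, hreg⟩ :=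
    RegularOffCodimFourResidue.exists_isBlowup_regular_off_codimFour hG h081R hP f₀ h3
  refine ⟨X', f, J, hf, hJ, B ∩ (Scheme.regularLocus X)ᶜ, hB.inter hTc, Set.inter_subset_right,
    fun b hb => hB4 b hb.1, fun x' hx' => ?_⟩
  by_cases hxB : f x' ∈ B
  · -- then `f x'` is a regular point of `X`, off `Supp J`, where `f` is an isomorphism
    have hxreg : f x' ∈ Scheme.regularLocus X := by
      by_contra h
      exact hx' ⟨hxB, h⟩
    have hxJ : f x' ∉ (J.support : Set X) := fun h => hJ h hxreg
    haveI := hf.isIso_compl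
    exact (Scheme.mem_regularLocus x').mp ((mem_regularLocus_iff_of_isIso_morphismRestrict f
      ⟨(J.support : Set X)ᶜ, J.support.isClosed.isOpen_compl⟩ x' hxJ).mpr hxreg)
  · exact hreg x' hxB

/-! ## §2 The component glue (Cossart–Piltant 2019, proof of Prop. 4.6, Step 1), in U1 currency -/

/-- The disjoint union of two reduced schemes is reduced. [folklore] -/
theorem isReduced_coprod {X Y : Scheme.{0}} [IsReduced X] [IsReduced Y] : IsReduced (X ⨿ Y) := by
  haveI : ∀ z : ↥(X ⨿ Y), _root_.IsReduced ((X ⨿ Y).presheaf.stalk z) := fun z => by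
    rcases coprod_point_cases z with ⟨x, rfl⟩ | ⟨y, rfl⟩
    · exact isReduced_of_injective
        (asIso ((coprod.inl : X ⟶ X ⨿ Y).stalkMap x)).commRingCatIsoToRingEquiv.toRingHom
        (asIso ((coprod.inl : X ⟶ X ⨿ Y).stalkMap x)).commRingCatIsoToRingEquiv.injective
    · exact isReduced_of_injective
        (asIso ((coprod.inr : Y ⟶ X ⨿ Y).stalkMap y)).commRingCatIsoToRingEquiv.toRingHom
        (asIso ((coprod.inr : Y ⟶ X ⨿ Y).stalkMap y)).commRingCatIsoToRingEquiv.injective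
  exact isReduced_of_isReduced_stalk _

/-- Local dimension only grows along a closed immersion: `dim 𝒪_{C,c} ≤ dim 𝒪_{X,ι c}` (the stalk map is surjective). [folklore] -/
theorem ringKrullDim_stalk_le_of_isClosedImmersion {C X : Scheme.{0}} (ι : C ⟶ X) [IsClosedImmersion ι] (c : C) :
    ringKrullDim (C.presheaf.stalk c) ≤ ringKrullDim (X.presheaf.stalk (ι.base c)) :=
  ringKrullDim_le_of_surjective (ι.stalkMap c).hom (ι.stalkMap_surjective c)

/-- **Glue along a closed cover.** If the reduced scheme `X` is covered by closed subschemes `ι₁ : C ↪ X`, `ι₂ : D ↪ X` with mutually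
dense complements and `C`, `D` have U1 models, so does `X`: the disjoint union of the two models (proper, birational, reduced), with
residue the union of the images of the two residues. [folklore assembly; cite: CossartPiltant2019, proof of Prop. 4.6, Step 1] -/
theorem regularOffCodimFourModel_of_closed_cover {C D X : Scheme.{0}} [IsReduced X]
    (ι₁ : C ⟶ X) (ι₂ : D ⟶ X) [IsClosedImmersion ι₁] [IsClosedImmersion ι₂]
    (hcov : Set.range ι₁ ∪ Set.range ι₂ = Set.univ)
    (hd₁ : Dense (ι₁ ⁻¹' (Set.range ι₂)ᶜ)) (hd₂ : Dense (ι₂ ⁻¹' (Set.range ι₁)ᶜ))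
    (h₁ : RegularOffCodimFourModel C) (h₂ : RegularOffCodimFourModel D) : RegularOffCodimFourModel X := by
  obtain ⟨C', ρ₁, hprop₁, hbir₁, hred₁, B₁, hB₁, hB₁4, hreg₁⟩ := h₁
  obtain ⟨D', ρ₂, hprop₂, hbir₂, hred₂, B₂, hB₂, hB₂4, hreg₂⟩ := h₂
  haveI := hprop₁
  haveI := hprop₂
  haveI := hred₁
  haveI := hred₂
  refine ⟨C' ⨿ D', coprod.desc (ρ₁ ≫ ι₁) (ρ₂ ≫ ι₂), ComponentGluing.isProper_coprodDesc _ _,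
    ComponentGluing.isBirational_coprodDesc_of_closed_cover ι₁ ι₂ hcov hd₁ hd₂ hbir₁ hbir₂, isReduced_coprod,
    ι₁.base '' B₁ ∪ ι₂.base '' B₂, ?_, ?_, ?_⟩
  · exact (ι₁.isClosedEmbedding.isClosedMap _ hB₁).union (ι₂.isClosedEmbedding.isClosedMap _ hB₂)
  · rintro b (⟨b₁, hb₁, rfl⟩ | ⟨b₂, hb₂, rfl⟩)
    · exact (hB₁4 b₁ hb₁).trans (ringKrullDim_stalk_le_of_isClosedImmersion ι₁ b₁)
    · exact (hB₂4 b₂ hb₂).trans (ringKrullDim_stalk_le_of_isClosedImmersion ι₂ b₂)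
  · intro z hz
    rcases coprod_point_cases z with ⟨x, rfl⟩ | ⟨y, rfl⟩
    · have hπ : (coprod.desc (ρ₁ ≫ ι₁) (ρ₂ ≫ ι₂)).base ((coprod.inl : C' ⟶ C' ⨿ D').base x) = ι₁.base (ρ₁.base x) := by
        rw [← Scheme.Hom.comp_apply, coprod.inl_desc, Scheme.Hom.comp_apply]
      have hx : ρ₁.base x ∉ B₁ := fun h => hz (by rw [hπ]; exact Or.inl ⟨_, h, rfl⟩)
      haveI := hreg₁ x hx
      exact IsRegularLocalRing.of_ringEquiv
        (asIso ((coprod.inl : C' ⟶ C' ⨿ D').stalkMap x)).commRingCatIsoToRingEquiv.symm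
    · have hπ : (coprod.desc (ρ₁ ≫ ι₁) (ρ₂ ≫ ι₂)).base ((coprod.inr : D' ⟶ C' ⨿ D').base y) = ι₂.base (ρ₂.base y) := by
        rw [← Scheme.Hom.comp_apply, coprod.inr_desc, Scheme.Hom.comp_apply]
      have hy : ρ₂.base y ∉ B₂ := fun h => hz (by rw [hπ]; exact Or.inr ⟨_, h, rfl⟩)
      haveI := hreg₂ y hy
      exact IsRegularLocalRing.of_ringEquiv
        (asIso ((coprod.inr : D' ⟶ C' ⨿ D').stalkMap y)).commRingCatIsoToRingEquiv.symm

/-- U1 models transport along isomorphisms of the target. [folklore] -/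
theorem regularOffCodimFourModel_of_iso {X Z : Scheme.{0}} (g : X ⟶ Z) [IsIso g]
    (h : RegularOffCodimFourModel X) : RegularOffCodimFourModel Z := by
  obtain ⟨X', π, hprop, hbir, hred, B, hB, hB4, hreg⟩ := h
  haveI := hprop
  refine ⟨X', π ≫ g, inferInstance, hbir.comp_iso g, hred, g.base '' B, ?_, ?_, ?_⟩
  · exact g.homeomorph.isClosedMap _ hB
  · rintro _ ⟨b, hb, rfl⟩
    have e : Z.presheaf.stalk (g.base b) ≃+* X.presheaf.stalk b := (asIso (g.stalkMap b)).commRingCatIsoToRingEquiv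
    rw [ringKrullDim_eq_of_ringEquiv e]
    exact hB4 b hb
  · intro x' hx'
    refine hreg x' fun h => hx' ?_
    rw [Scheme.Hom.comp_apply]
    exact ⟨_, h, rfl⟩

/-- A regular scheme is its own U1 model (empty residue). [folklore] -/
theorem regularOffCodimFourModel_of_isRegular {X : Scheme.{0}} [IsReduced X] (h : Scheme.IsRegular X) :
    RegularOffCodimFourModel X := by
  refine ⟨X, 𝟙 X, inferInstance, ⟨⊤, ?_, ?_, ?_⟩, inferInstance, ∅, isClosed_empty,
    fun _ hb => absurd hb (Set.notMem_empty _), fun x _ => h x⟩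
  · simp
  · simp
  · infer_instance


/-! ## §3 Induction over the irreducible components -/

section Components

variable {X : Scheme.{0}}

/-- **U1 model of a finite union of irreducible components** of a reduced scheme, given a model of each component with its reduced
(integral) closed-subscheme structure — the induction of `ComponentGluing.hasResolution_subscheme_biUnion` verbatim in U1 currency.
[folklore assembly; cite: CossartPiltant2019, proof of Prop. 4.6, Step 1] -/
theorem regularOffCodimFourModel_subscheme_biUnion [IsReduced X]
    (hres : ∀ Z : Closeds X, (Z : Set X) ∈ irreducibleComponents X →
      RegularOffCodimFourModel (vanishingIdeal Z).subscheme)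
    (S : Finset (Set X)) (hS : (S : Set (Set X)) ⊆ irreducibleComponents X) (T : Closeds X)
    (hT : (T : Set X) = ⋃ Z ∈ S, Z) :
    RegularOffCodimFourModel (vanishingIdeal T).subscheme := by
  classical
  induction S using Finset.induction_on generalizing T with
  | empty =>
    have hT' : (T : Set X) = ∅ := by simpa using hT
    haveI : IsEmpty (vanishingIdeal T).subscheme := ⟨fun x => by
      have := ComponentGluing.mem_of_subscheme_vanishingIdeal T x
      rw [← SetLike.mem_coe, hT'] at this
      exact this⟩
    haveI : IsReduced (vanishingIdeal T).subscheme := ComponentGluing.isReduced_subscheme_vanishingIdeal T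
    exact regularOffCodimFourModel_of_isRegular fun x => (IsEmpty.false x).elim
  | insert Z S hZS ih =>
    have hZ : Z ∈ irreducibleComponents X := hS (Finset.mem_insert_self Z S)
    have hS' : (S : Set (Set X)) ⊆ irreducibleComponents X :=
      fun W hW => hS (Finset.mem_insert_of_mem hW)
    let T₁ : Closeds X := ⟨Z, isClosed_of_mem_irreducibleComponents Z hZ⟩
    let T₂ : Closeds X := ⟨⋃ W ∈ S, W, isClosed_biUnion_finset fun W hW =>
      isClosed_of_mem_irreducibleComponents W (hS' hW)⟩
    have hT₁₂ : (T : Set X) = (T₁ : Set X) ∪ T₂ := by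
      rw [hT, Finset.set_biUnion_insert]; rfl
    have h₁T : T₁ ≤ T := by
      intro x hx; rw [← SetLike.mem_coe, hT₁₂]; exact Or.inl hx
    have h₂T : T₂ ≤ T := by
      intro x hx; rw [← SetLike.mem_coe, hT₁₂]; exact Or.inr hx
    have hZT₂ : ¬ (Z ⊆ (T₂ : Set X)) := fun h =>
      hZS (ComponentGluing.mem_of_subset_biUnion_of_mem_irreducibleComponents hZ S hS' h)
    have hWZ : ∀ W ∈ S, ¬ (W ⊆ Z) := by
      intro W hW h
      have : W = Z := Set.Subset.antisymm h ((hS' hW).2 hZ.1 h)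
      exact hZS (this ▸ hW)
    let ι₁ := inclusion (vanishingIdeal_antimono h₁T)
    let ι₂ := inclusion (vanishingIdeal_antimono h₂T)
    haveI : IsReduced (vanishingIdeal T).subscheme := ComponentGluing.isReduced_subscheme_vanishingIdeal T
    have h₁ : RegularOffCodimFourModel (vanishingIdeal T₁).subscheme := hres T₁ hZ
    have h₂ := ih hS' T₂ rfl
    refine regularOffCodimFourModel_of_closed_cover ι₁ ι₂ ?_ ?_ ?_ h₁ h₂
    · refine Set.eq_univ_of_forall fun y => ?_
      have hy := ComponentGluing.mem_of_subscheme_vanishingIdeal T y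
      rw [← SetLike.mem_coe, hT₁₂] at hy
      rcases hy with hy | hy
      · left; rw [ComponentGluing.range_inclusion]; exact hy
      · right; rw [ComponentGluing.range_inclusion]; exact hy
    · rw [ComponentGluing.range_inclusion]
      have hopen :
          IsOpen (ι₁ ⁻¹' ((vanishingIdeal T).subschemeι ⁻¹' (T₂ : Set X))ᶜ) :=
        (T₂.2.preimage (vanishingIdeal T).subschemeι.continuous).isOpen_compl.preimage
          ι₁.continuous
      haveI : IsIntegral (vanishingIdeal T₁).subscheme :=
        ComponentGluing.isIntegral_subscheme_vanishingIdeal T₁ hZ.1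
      refine hopen.dense ?_
      obtain ⟨x, hxZ, hxT₂⟩ := Set.not_subset.mp hZT₂
      have hx : x ∈ Set.range (vanishingIdeal T₁).subschemeι := by
        rw [ComponentGluing.range_subschemeι_vanishingIdeal]; exact hxZ
      obtain ⟨c, rfl⟩ := hx
      refine ⟨c, ?_⟩
      show (vanishingIdeal T).subschemeι (ι₁ c) ∉ (T₂ : Set X)
      rw [ComponentGluing.subschemeι_inclusion_apply]
      exact hxT₂
    · rw [ComponentGluing.range_inclusion, dense_iff_inter_open]
      intro O' hO' hO'ne
      obtain ⟨O, hO, rfl⟩ :=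
        (vanishingIdeal T₂).subschemeι.isClosedEmbedding.isInducing.isOpen_iff.mp hO'
      obtain ⟨d₀, hd₀⟩ := hO'ne
      have hd₀T : (vanishingIdeal T₂).subschemeι d₀ ∈ (T₂ : Set X) :=
        ComponentGluing.mem_of_subscheme_vanishingIdeal T₂ d₀
      obtain ⟨W, hW, hd₀W⟩ := Set.mem_iUnion₂.mp hd₀T
      have hWirr : IsPreirreducible W := (hS' hW).1.2
      obtain ⟨x, hxW, hxO, hxZ⟩ := hWirr O Zᶜ hO
        (isClosed_of_mem_irreducibleComponents Z hZ).isOpen_compl ⟨_, hd₀W, hd₀⟩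
        (by
          obtain ⟨x, hxW, hxZ⟩ := Set.not_subset.mp (hWZ W hW)
          exact ⟨x, hxW, hxZ⟩)
      have hx : x ∈ Set.range (vanishingIdeal T₂).subschemeι := by
        rw [ComponentGluing.range_subschemeι_vanishingIdeal]; exact Set.mem_iUnion₂.mpr ⟨W, hW, hxW⟩
      obtain ⟨d, rfl⟩ := hx
      refine ⟨d, hxO, ?_⟩
      show (vanishingIdeal T).subschemeι (ι₂ d) ∉ (T₁ : Set X)
      rw [ComponentGluing.subschemeι_inclusion_apply]
      exact hxZ

/-- **Reduction of U1 to the irreducible components** (`ComponentGluing.hasResolution_of_irreducibleComponents` in U1 currency).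
[folklore assembly; cite: CossartPiltant2019, proof of Prop. 4.6, Step 1] -/
theorem regularOffCodimFourModel_of_irreducibleComponents (X : Scheme.{0}) [IsReduced X]
    (hfin : (irreducibleComponents (X : Type)).Finite)
    (hres : ∀ Z : Closeds X, (Z : Set X) ∈ irreducibleComponents X →
      RegularOffCodimFourModel (vanishingIdeal Z).subscheme) :
    RegularOffCodimFourModel X := by
  classical
  have h := regularOffCodimFourModel_subscheme_biUnion hres hfin.toFinset (by simp) ⊤ (by
    refine (Set.eq_univ_of_forall fun x => ?_).trans Set.top_eq_univ.symm |>.symm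
    exact Set.mem_iUnion₂.mpr ⟨irreducibleComponent x,
      hfin.mem_toFinset.mpr (irreducibleComponent_mem_irreducibleComponents x),
      mem_irreducibleComponent⟩)
  haveI := ComponentGluing.isIso_subschemeι_vanishingIdeal_top (X := X)
  exact regularOffCodimFourModel_of_iso (vanishingIdeal (⊤ : Closeds X)).subschemeι h

end Components

/-! ## §4 Strat-1's (U1) for reduced `X` -/

/-- A reduced `k`-scheme of finite type has a U1 model as soon as every integral closed subscheme has one
(`ComponentGluing.hasResolution_of_forall_closeds` in U1 currency). [folklore assembly; cite: CossartPiltant2019, proof of Prop. 4.6, Step 1] -/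
theorem regularOffCodimFourModel_of_forall_closeds {k : Type} [Field k] (X : Scheme.{0}) (f : X ⟶ Spec (.of k))
    [LocallyOfFiniteType f] [QuasiCompact f] [IsReduced X]
    (h : ∀ Z : Closeds X, IsIntegral (vanishingIdeal Z).subscheme →
      RegularOffCodimFourModel (vanishingIdeal Z).subscheme) :
    RegularOffCodimFourModel X := by
  haveI : IsLocallyNoetherian X := LocallyOfFiniteType.isLocallyNoetherian f
  haveI : CompactSpace X := QuasiCompact.compactSpace_of_compactSpace f
  haveI : IsNoetherian X := {}
  exact regularOffCodimFourModel_of_irreducibleComponents X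
    TopologicalSpace.NoetherianSpace.finite_irreducibleComponents
    fun Z hZ => h Z (ComponentGluing.isIntegral_subscheme_of_mem_irreducibleComponents Z hZ)

/-- **(U1) `RegularOffCodimFourResidue` — res-L1-w45a-strat-1's `UReduction.RegularOffCodimFourResidue` (ULine v1.5) VERBATIM**, for
every REDUCED separated finite-type scheme over a field of positive characteristic: proper birational reduced `X₂ → X` regular off the
preimage of a closed set of points of local dimension `≥ 4`. The components (integral closed subschemes, separated of finite type over
`k`) are treated by `regularOffCodimFourModel_of_isIntegral` and glued along `ComponentGluing`. `stub_regularOffCodimFourResidue`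
closes by this, modulo `CossartPiltant2019General` + `Stacks081R` + `CossartPiltant2019Principalization` BY NAME.
[folklore assembly; cite: Temkin2008, Prop. 2.3.4; CossartPiltant2019, Thm. 1.1 and proof of Prop. 4.6 (Step 1)] -/
theorem regularOffCodimFourResidue_of_cp
    (hG : CossartPiltant2019General.{0}) (h081R : Stacks081R.{0}) (hP : CossartPiltant2019Principalization.{0}) :
    ∀ p : ℕ, p.Prime → ∀ (k : Type) [Field k] [CharP k p] (X : Scheme.{0}) (f : X ⟶ Spec (.of k)),
    IsSeparated f → LocallyOfFiniteType f → QuasiCompact f → IsReduced X →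
    ∃ (X₂ : Scheme.{0}) (π₂ : X₂ ⟶ X), IsProper π₂ ∧ IsBirational π₂ ∧ IsReduced X₂ ∧
      ∃ B : Set X, IsClosed B ∧ (∀ b ∈ B, (4 : WithBot ℕ∞) ≤ ringKrullDim (X.presheaf.stalk b)) ∧
        ∀ x₂ : X₂, π₂.base x₂ ∉ B → IsRegularLocalRing (X₂.presheaf.stalk x₂) := by
  intro p _ k _ _ X f hsep hft hqc hred
  haveI := hsep
  haveI := hft
  haveI := hqc
  haveI := hred
  exact regularOffCodimFourModel_of_forall_closeds X f fun Z hZ => by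
    haveI := hZ
    exact regularOffCodimFourModel_of_isIntegral hG h081R hP _ ((vanishingIdeal Z).subschemeι ≫ f)

end Summit.ResolutionOfSingularities.ResolutionOfSingularities.Theorems.FInjectiveMacaulayfication.RegularOffCodimFourResidueReduced

end
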